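import Mathlib
import HarnessLib
import Summits.HubbardSuperconductivity.HubbardSuperconductivity.Theorems.KLProgrammeKLRegimeTwoVolumeLipRemeasureSup

/-!
# Route `KLProgramme` — crux K3 ENGINE (stmt-HubbardSuperconductivity-20437), stub (e) proof-input «(e)-D-ROWS»: THE BASE TERM OF THE (Dμ) ROW IS A JUMP OF THE
# SCALE-0 ANALYSED PAIR — `hbase` of `…LipRemeasureSup.klLipInputDiffSup_le_remeasured` discharged down to the scale-0 two-volume difference
# (seat hubbard-kl-k3c4-p1 g24; `--supports` 20437; DROWS-SCOPE-g24 v8 §10.2/§10.4)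

The (Dμ) row (`…TwoVolumeLipRemeasureSup.klLipInputDiffSup_le_remeasured`, p709178) names a base size `B₀`: a bound of the pinned sums, at `(D₀+r)`-deep pins of
`Γ_k(bL)`, of `sectorPreimage β F_{dk−1}(bL) 𝒱⁽⁰⁾(bL) − klGlue (sectorPreimage β F_{dk−1}(L) 𝒱⁽⁰⁾(L))` (`𝒱⁽⁰⁾(V) = klEffectiveAction V … 0`).  By the plateau identity
`…LipJumpDefs.sectorPreimage_eq_map_klJump` (`0 + 1 ≤ dk − 1`, i.e. `2 ≤ dk`) each analysed action is the JUMP `klJump V … (dk−1) 0` of the SCALE-0 ANALYSED action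
`A_V := sectorPreimage β F_0(V) 𝒱⁽⁰⁾(V)`, so the base term is `map (toLin′ (klJump (bL) … (dk−1) 0)) A_{bL} − klGlue (map (toLin′ (klJump L … (dk−1) 0)) A_L)` — the element of
the canonical jump door `…LipJumpRows.klJump_transfer_le_of_scaleWtRows` with defect **`BD_base := A_{bL} − klGlue A_L`** (the two-volume difference of the UV
effective actions analysed at `F_0`; T3-Lip's `db`-base object, G-4) and coarse profiles = the profiles of `A_L` (E1's scale-0 rows, `…ScaleZeroKernelNormsWt`).

* `lipBase_eq_jump` — the identity; `lipBase_le_of_scaleWtRows` — the base term at a `(D₀+r)`-deep pin `≤ cWⁿ(cW·E_b + τ·ND_b) + (2cWⁿτN_b + n·cWⁿ(5τN_b + 2cW·N^{far}_b))`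
  (`τ = cW/(1+Λ_T(r+1))`; named: `klScaleWt`-weighted rows `cW` of `klJump (bL) … (dk−1) 0`, profiles `N_b`, `N^{far}_b` of `A_L`, `E_b` (pins within `r`) / `ND_b` of `BD_base`);
* **`klLipInputDiffSup_le_remeasured_of_base`** — the (Dμ) row with `hbase` DISCHARGED: `B₀ := ` the displayed bound with `E_b` read at `D₀`-deep pins.

Compositions of landed theorems; nothing asserts the (D) rows, stub (e), VL, K3 or superconductivity.
References: BGM 2006 §2.7 (2.71), §2.8 (2.76)–(2.90), §3 [cite: BenfattoGiulianiMastropietro2006].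
-/

namespace Summit.HubbardSuperconductivity.HubbardSuperconductivity.Theorems.TwoVolumeLip

set_option linter.dupNamespace false -- summit = problem name (single-conjunct summit), D-0017

open Finset Literature.MathematicalPhysics.QuantumLattice GrassmannAlgebra Literature.Probability.LatticeModels
open Literature.MathematicalPhysics.QuantumLattice.FermiRG
open Summit.HubbardSuperconductivity.HubbardSuperconductivity.Theorems.KLRegimeSplit
open Summit.HubbardSuperconductivity.HubbardSuperconductivity.Theorems.KLProgrammeLegKernels
open Summit.HubbardSuperconductivity.HubbardSuperconductivity.Theorems.DispersionFlow
open Summit.HubbardSuperconductivity.HubbardSuperconductivity.Theorems.EngineV8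
open Summit.HubbardSuperconductivity.HubbardSuperconductivity.Theorems.TwoVolumeSource
open Summit.HubbardSuperconductivity.HubbardSuperconductivity.Theorems.TwoVolumeDefect

noncomputable section

variable {L b M : ℕ} [NeZero L] [NeZero (b * L)] [NeZero M]

/-- **The base term is a jump of the scale-0 analysed pair** (`β ≠ 0`, `2 ≤ dk`). -/
theorem lipBase_eq_jump {β : ℝ} (hβ : β ≠ 0) (U μ : ℝ) (K : TrigPolyC4v) {d k : ℕ} (hdk : 2 ≤ d * k) :
    sectorPreimage β (klAnisoFamily (b * L) M β μ K klE0 (d * k - 1)) (klEffectiveAction (b * L) M β U μ K klE0 0) -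
        klGlue L b M (sectorCount (d * k - 1)) (sectorPreimage β (klAnisoFamily L M β μ K klE0 (d * k - 1)) (klEffectiveAction L M β U μ K klE0 0)) =
      ExteriorAlgebra.map (Matrix.toLin' (klJump (b * L) M β μ K (d * k - 1) 0))
          (sectorPreimage β (klAnisoFamily (b * L) M β μ K klE0 0) (klEffectiveAction (b * L) M β U μ K klE0 0)) -
        klGlue L b M (sectorCount (d * k - 1))
          (ExteriorAlgebra.map (Matrix.toLin' (klJump L M β μ K (d * k - 1) 0))
            (sectorPreimage β (klAnisoFamily L M β μ K klE0 0) (klEffectiveAction L M β U μ K klE0 0))) := by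
  have hJ : 0 + 1 ≤ d * k - 1 := by omega
  rw [sectorPreimage_eq_map_klJump hβ μ K hJ (klEffectiveAction (b * L) M β U μ K klE0 0),
    sectorPreimage_eq_map_klJump hβ μ K hJ (klEffectiveAction L M β U μ K klE0 0)]

/-- **The base term at a deep pin through the jump door.**  For `2 ≤ dk`, `0 < β`, a `(D₀+r)`-deep pin `w′` of `Γ_k(bL)` (`2r ≤ D₀`), a rate `j_r` with
`0 ≤ Λ_T ≤ Λ_{j_r}` and `klScaleWt (bL) M β j_r`-weighted row / column sums of `klJump (bL) … (dk−1) 0` at most `cW`: the pinned kernel sum of the base term of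
the (Dμ) row in degree `n+1` is at most `cWⁿ(cW·E_b + τ·ND_b) + (2cWⁿτN_b + n·cWⁿ(5τN_b + 2cW·N^{far}_b))`, where `N_b`, `N^{far}_b` are the plain / `r`-far profiles
of the coarse scale-0 analysed action `A_L` and `E_b` (pins within `r` of `w′`), `ND_b` (all pins) those of `BD_base = A_{bL} − klGlue A_L`. -/
theorem lipBase_le_of_scaleWtRows {β : ℝ} (hβ : 0 < β) (U μ : ℝ) (K : TrigPolyC4v) {d k : ℕ} (hdk : 2 ≤ d * k) (jr : ℕ)
    {ΛT cW : ℝ} (hΛT : 0 ≤ ΛT) (hΛr : ΛT ≤ klScale klE0 jr) (hcW : 0 ≤ cW)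
    (hrow : ∀ x, ∑ y', ‖klJump (b * L) M β μ K (d * k - 1) 0 x y'‖ *
      klScaleWt (b * L) M β jr {latticeLegPos (2 * (2 * M)) x, latticeLegPos (2 * (2 * M)) y'} ≤ cW)
    (hcol : ∀ y', ∑ x, ‖klJump (b * L) M β μ K (d * k - 1) 0 x y'‖ *
      klScaleWt (b * L) M β jr {latticeLegPos (2 * (2 * M)) x, latticeLegPos (2 * (2 * M)) y'} ≤ cW)
    {n : ℕ} (p : Fin (n + 1)) (w' : SpaceTimeIdx (b * L) M × SectorLeg (sectorCount (d * k - 1))) (D₀ r : ℕ) (hD₀ : 2 * r ≤ D₀)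
    (hw : ∀ i, D₀ + r ≤ (w'.1.2 i).val % L ∧ (w'.1.2 i).val % L + (D₀ + r) < L)
    {Nb Nbfar Eb NDb : ℝ} (hNb0 : 0 ≤ Nb) (hNbfar0 : 0 ≤ Nbfar) (hEb0 : 0 ≤ Eb) (hNDb0 : 0 ≤ NDb)
    (hNb : ∀ y, ∑ Y ∈ univ.filter (fun Y : Fin (n + 1) → SpaceTimeIdx L M × SectorLeg (sectorCount 0) => Y p = y),
      ‖kernel ℂ (sectorPreimage β (klAnisoFamily L M β μ K klE0 0) (klEffectiveAction L M β U μ K klE0 0)) (n + 1) Y‖ ≤ Nb)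
    (hNbfar : ∀ y (i : Fin (n + 1)),
      ∑ Y ∈ univ.filter (fun Y : Fin (n + 1) → SpaceTimeIdx L M × SectorLeg (sectorCount 0) => Y p = y ∧ r < Torus.tnorm ((Y p).1.2 - (Y i).1.2)),
        ‖kernel ℂ (sectorPreimage β (klAnisoFamily L M β μ K klE0 0) (klEffectiveAction L M β U μ K klE0 0)) (n + 1) Y‖ ≤ Nbfar)
    (hEb : ∀ y' : SpaceTimeIdx (b * L) M × SectorLeg (sectorCount 0), Torus.tnorm (w'.1.2 - y'.1.2) ≤ r →
      ∑ Y' ∈ univ.filter (fun Y' : Fin (n + 1) → SpaceTimeIdx (b * L) M × SectorLeg (sectorCount 0) => Y' p = y'),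
        ‖kernel ℂ (sectorPreimage β (klAnisoFamily (b * L) M β μ K klE0 0) (klEffectiveAction (b * L) M β U μ K klE0 0) -
            klGlue L b M (sectorCount 0) (sectorPreimage β (klAnisoFamily L M β μ K klE0 0) (klEffectiveAction L M β U μ K klE0 0))) (n + 1) Y'‖ ≤ Eb)
    (hNDb : ∀ y', ∑ Y' ∈ univ.filter (fun Y' : Fin (n + 1) → SpaceTimeIdx (b * L) M × SectorLeg (sectorCount 0) => Y' p = y'),
        ‖kernel ℂ (sectorPreimage β (klAnisoFamily (b * L) M β μ K klE0 0) (klEffectiveAction (b * L) M β U μ K klE0 0) -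
            klGlue L b M (sectorCount 0) (sectorPreimage β (klAnisoFamily L M β μ K klE0 0) (klEffectiveAction L M β U μ K klE0 0))) (n + 1) Y'‖ ≤ NDb) :
    ∑ X' ∈ univ.filter (fun X' : Fin (n + 1) → SpaceTimeIdx (b * L) M × SectorLeg (sectorCount (d * k - 1)) => X' p = w'),
        ‖kernel ℂ (sectorPreimage β (klAnisoFamily (b * L) M β μ K klE0 (d * k - 1)) (klEffectiveAction (b * L) M β U μ K klE0 0) -
            klGlue L b M (sectorCount (d * k - 1))
              (sectorPreimage β (klAnisoFamily L M β μ K klE0 (d * k - 1)) (klEffectiveAction L M β U μ K klE0 0))) (n + 1) X'‖ ≤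
      cW ^ n * (cW * Eb + cW / (1 + ΛT * ((r : ℝ) + 1)) * NDb) +
        (2 * cW ^ n * (cW / (1 + ΛT * ((r : ℝ) + 1))) * Nb + n * cW ^ n * (5 * (cW / (1 + ΛT * ((r : ℝ) + 1))) * Nb + 2 * cW * Nbfar)) := by
  rw [lipBase_eq_jump hβ.ne' U μ K hdk]
  exact klJump_transfer_le_of_scaleWtRows hβ μ K (d * k - 1) 0 jr hΛT hΛr hcW hrow hcol _ _ p w' D₀ r hD₀ hw hNb0 hNbfar0 hEb0 hNDb0 hNb hNbfar hEb hNDb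

/-- **The (Dμ) row with the base DISCHARGED** — `…LipRemeasureSup.klLipInputDiffSup_le_remeasured` with `B₀ := cWⁿ(cW·E_b + τ·ND_b) + (2cWⁿτN_b + n·cWⁿ(5τN_b + 2cW·N^{far}_b))`
from `lipBase_le_of_scaleWtRows` (`E_b` read at the `D₀`-deep pins, `…LipDiffSups.mem_klDeepPins_of_tnorm_le`); `2 ≤ d`, `1 ≤ k`. -/
theorem klLipInputDiffSup_le_remeasured_of_base {β : ℝ} (hβ : 0 < β) (U μ : ℝ) (K : TrigPolyC4v) {d : ℕ} (hd : 2 ≤ d) {k : ℕ} (hk : 1 ≤ k) (n D₀ r jr : ℕ)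
    (hD₀ : 2 * r ≤ D₀) {ΛT cW : ℝ} (hΛT : 0 ≤ ΛT) (hΛr : ΛT ≤ klScale klE0 jr) (hcW : 0 ≤ cW)
    (hrow : ∀ k' ∈ range k, ∀ x, ∑ y', ‖klJump (b * L) M β μ K (d * k - 1) (d * k') x y'‖ *
      klScaleWt (b * L) M β jr {latticeLegPos (2 * (2 * M)) x, latticeLegPos (2 * (2 * M)) y'} ≤ cW)
    (hcol : ∀ k' ∈ range k, ∀ y', ∑ x, ‖klJump (b * L) M β μ K (d * k - 1) (d * k') x y'‖ *
      klScaleWt (b * L) M β jr {latticeLegPos (2 * (2 * M)) x, latticeLegPos (2 * (2 * M)) y'} ≤ cW)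
    (hrow0 : ∀ x, ∑ y', ‖klJump (b * L) M β μ K (d * k - 1) 0 x y'‖ *
      klScaleWt (b * L) M β jr {latticeLegPos (2 * (2 * M)) x, latticeLegPos (2 * (2 * M)) y'} ≤ cW)
    (hcol0 : ∀ y', ∑ x, ‖klJump (b * L) M β μ K (d * k - 1) 0 x y'‖ *
      klScaleWt (b * L) M β jr {latticeLegPos (2 * (2 * M)) x, latticeLegPos (2 * (2 * M)) y'} ≤ cW)
    {Nb Nbfar Eb NDb : ℝ} (hNb0 : 0 ≤ Nb) (hNbfar0 : 0 ≤ Nbfar) (hEb0 : 0 ≤ Eb) (hNDb0 : 0 ≤ NDb)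
    (hNb : ∀ (q : Fin (n + 1)) y, ∑ Y ∈ univ.filter (fun Y : Fin (n + 1) → SpaceTimeIdx L M × SectorLeg (sectorCount 0) => Y q = y),
      ‖kernel ℂ (sectorPreimage β (klAnisoFamily L M β μ K klE0 0) (klEffectiveAction L M β U μ K klE0 0)) (n + 1) Y‖ ≤ Nb)
    (hNbfar : ∀ (q : Fin (n + 1)) y (i : Fin (n + 1)),
      ∑ Y ∈ univ.filter (fun Y : Fin (n + 1) → SpaceTimeIdx L M × SectorLeg (sectorCount 0) => Y q = y ∧ r < Torus.tnorm ((Y q).1.2 - (Y i).1.2)),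
        ‖kernel ℂ (sectorPreimage β (klAnisoFamily L M β μ K klE0 0) (klEffectiveAction L M β U μ K klE0 0)) (n + 1) Y‖ ≤ Nbfar)
    (hEb : ∀ (q : Fin (n + 1)) (y' : SpaceTimeIdx (b * L) M × SectorLeg (sectorCount 0)), y' ∈ klDeepPins L D₀ →
      ∑ Y' ∈ univ.filter (fun Y' : Fin (n + 1) → SpaceTimeIdx (b * L) M × SectorLeg (sectorCount 0) => Y' q = y'),
        ‖kernel ℂ (sectorPreimage β (klAnisoFamily (b * L) M β μ K klE0 0) (klEffectiveAction (b * L) M β U μ K klE0 0) -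
            klGlue L b M (sectorCount 0) (sectorPreimage β (klAnisoFamily L M β μ K klE0 0) (klEffectiveAction L M β U μ K klE0 0))) (n + 1) Y'‖ ≤ Eb)
    (hNDb : ∀ (q : Fin (n + 1)) y', ∑ Y' ∈ univ.filter (fun Y' : Fin (n + 1) → SpaceTimeIdx (b * L) M × SectorLeg (sectorCount 0) => Y' q = y'),
        ‖kernel ℂ (sectorPreimage β (klAnisoFamily (b * L) M β μ K klE0 0) (klEffectiveAction (b * L) M β U μ K klE0 0) -
            klGlue L b M (sectorCount 0) (sectorPreimage β (klAnisoFamily L M β μ K klE0 0) (klEffectiveAction L M β U μ K klE0 0))) (n + 1) Y'‖ ≤ NDb)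
    {N Nfar : ℕ → ℝ} (hN0 : ∀ k', 0 ≤ N k') (hNfar0 : ∀ k', 0 ≤ Nfar k')
    (hN : ∀ k' ∈ range k, ∀ (q : Fin (n + 1)) (y : SpaceTimeIdx L M × SectorLeg (sectorCount (d * k'))),
      ∑ Y ∈ univ.filter (fun Y : Fin (n + 1) → SpaceTimeIdx L M × SectorLeg (sectorCount (d * k')) => Y q = y),
        ‖kernel ℂ (klLipBorn L M β U μ K d k') (n + 1) Y‖ ≤ N k')
    (hNfar : ∀ k' ∈ range k, ∀ (q : Fin (n + 1)) (y : SpaceTimeIdx L M × SectorLeg (sectorCount (d * k'))) (i : Fin (n + 1)),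
      ∑ Y ∈ univ.filter (fun Y : Fin (n + 1) → SpaceTimeIdx L M × SectorLeg (sectorCount (d * k')) =>
          Y q = y ∧ r < Torus.tnorm ((Y q).1.2 - (Y i).1.2)), ‖kernel ℂ (klLipBorn L M β U μ K d k') (n + 1) Y‖ ≤ Nfar k') :
    klLipInputDiffSup L b M β U μ K d k (n + 1) (D₀ + r) ≤
      (cW ^ n * (cW * Eb + cW / (1 + ΛT * ((r : ℝ) + 1)) * NDb) +
          (2 * cW ^ n * (cW / (1 + ΛT * ((r : ℝ) + 1))) * Nb + n * cW ^ n * (5 * (cW / (1 + ΛT * ((r : ℝ) + 1))) * Nb + 2 * cW * Nbfar))) +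
        ∑ k' ∈ range k,
          (cW ^ n * (cW * klLipBornDiffSup L b M β U μ K d k' (n + 1) D₀ +
              cW / (1 + ΛT * ((r : ℝ) + 1)) * klLipBornDiffSup L b M β U μ K d k' (n + 1) 0) +
            (2 * cW ^ n * (cW / (1 + ΛT * ((r : ℝ) + 1))) * N k' +
              n * cW ^ n * (5 * (cW / (1 + ΛT * ((r : ℝ) + 1))) * N k' + 2 * cW * Nfar k'))) := by
  have hdk : 2 ≤ d * k := le_trans (by omega) (Nat.mul_le_mul hd hk)
  have hτ : 0 ≤ cW / (1 + ΛT * ((r : ℝ) + 1)) := by positivity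
  refine klLipInputDiffSup_le_remeasured hβ U μ K hd k n D₀ r jr hD₀ hΛT hΛr hcW hrow hcol (by positivity) (fun q w hw => ?_) hN0 hNfar0 hN hNfar
  have hw' : ∀ j, D₀ + r ≤ (w.1.2 j).val % L ∧ (w.1.2 j).val % L + (D₀ + r) < L := mem_klDeepPins.1 hw
  exact lipBase_le_of_scaleWtRows hβ U μ K hdk jr hΛT hΛr hcW hrow0 hcol0 q w D₀ r hD₀ hw' hNb0 hNbfar0 hEb0 hNDb0 (hNb q) (hNbfar q)
    (fun y' hy' => hEb q y' (mem_klDeepPins_of_tnorm_le hw' hy')) (hNDb q)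

end

end Summit.HubbardSuperconductivity.HubbardSuperconductivity.Theorems.TwoVolumeLip
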